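import Summits.BirchSwinnertonDyer.Rank1Residual.Additive.RamifiedSevenGenusFrameArithmeticKernels
import HarnessLib

/-!
# K2C-14 (P2/4) — the ARITHMETIC INPUTS of a `𝒞₇` genus frame (`GenusSeven.GenusFrame`): Gauss sums §A5

Port (pen `bsd-cm` D1059) of the crux workfile `Cruxes/EllipticUnitValueSevenOfGZK/K2C14GenusFrameArithmeticInputs_g77.lean`
(commit e142b9ea3ae9, tree sha16 80281c1844350e71) by seat bsd-idea-20 g77; row K2C-14 (pen D1048).

Cell bsd-cm, seat bsd-idea-20 g77 (planner, crux-level, W-79 publish-only), crux `EllipticUnitValueSevenOfGZK`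
(stmt-BirchSwinnertonDyer-19945, route K7r `RamifiedSevenEllipticUnits`).  Specification = the K2C-11 inventory memo v3
`Cruxes/EllipticUnitValueSevenOfGZK/K2C11ConstructionInventory_g76.md` (tree 12ee9b0d407224ef) §1(b)/(c); row card
`pub/bsd-cm/bsd-cm-plan/g37/SUMMON-typers-K2C-13-16.md` (7e0dfdb9162e356c); pen rulings D1044 (C), D1045, D1048.

SPLIT (pen D1061; the tree's 400-line rule for files with proofs): the port is FOUR files with one namespace
`Summit.BirchSwinnertonDyer.Rank1Residual.Additive.GenusSeven.ArithmeticInputs` and a linear import chain —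
P1 `RamifiedSevenGenusFrameArithmeticKernels.lean` (§A1–A4), P2 `RamifiedSevenGenusFrameGaussSqrt.lean` (§A5),
P3 `RamifiedSevenGenusFrameArithmeticInputs.lean` (§B part 1: `v` … `ω`), P4 `RamifiedSevenGenusFrameArithmeticInputsEta.lean`
(§B part 2: `etaOne_isPrimitive`, `g`, `r`, `η₁`, the assembly check `mkGenusFrame`).  Content = commit e142b9ea3ae9 verbatim up to
the five D1059 edits (namespace, `set_option`, draft sentence) and this split.

THIS PART (P2):
* (A5) `exists_gaussSqrt` — for odd squarefree `m` an element `G ∈ rootField m = ℚ(μ_m)`, `G ≠ 0`, `G² = χ₄(m)·m`, on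
  which every `σ ∈ Aut(ℚ̄/ℚ)` with `σζ = ζ^a (ζ ∈ μ_m)` acts by the Jacobi symbol `(a | m)` (prime-by-prime: Mathlib
  `gaussSum_sq` on the FIELD `ZMod q`, `gaussSum_mulShift`, induction `Nat.recOnPosPrimePosCoprime`); hence
  `quadraticField_le_adjoin_rootsOfUnity` (`ℚ(√D) ⊆ ℚ(μ_{|D|})`, the letter of `F₀_le`).

FINDINGS (boxed for the pen; none is a letter deviation):
  ┌ (F1) `hKL`.  `g`/`g_spec` are the only declarations under the named fact `iwasawa_existsUnique_kubotaLeopoldtSeries`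
  │      (row card: «displayed hypothesis hKL»); `genusFrameOf … (hKL) …` must thread it.  Everything else is unconditional.
  │ (F2) `[NeZero D.natAbs]`.  `χD`, `zetaLevel/ζsys`, `etaOne/galToPow/η₁`, `g` carry the instance binder (Mathlib's
  │      `jacobiCharInt`/`DirichletCharacter` API wants it); at the frame constructor: `haveI := ⟨Int.natAbs_ne_zero.mpr hD.ne⟩`.
  │      The field `g_spec : ∀ [NeZero D.natAbs], …` is then `g_spec D hKL hD4 hsq h7` (instances of a `Prop`-class agree).
  │ (F3) ℚ-ALGEBRA DIAMOND on `ℚ̄`.  A freshly elaborated `ℚ̄ ≃ₐ[ℚ] ℚ̄` / `IntermediateField ℚ ℚ̄` picks Mathlib's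
  │      `DivisionRing.toRatAlgebra`, while `absoluteGaloisGroup.toAlgEquiv ℚ σ` lands at `AlgebraicClosure.instAlgebra ℚ`; the two
  │      are DEFINITIONALLY equal but not at `instances` transparency: pass between them with `exact`/`Eq.trans`, never `rw`
  │      (see `η₁_trivial`, χ_D-part).  No statement is affected.
  │ (F4) `MulChar.ofUnitHom (f ^ n) = MulChar.ofUnitHom f ^ n` (`ofUnitHom_pow`) is not in Mathlib; 3 lines here.
  └ (F5) `u = 64`, `χ₇(σ₈) = 8`, `γ₀ = σ₈²` exactly as the row card; `σ₈` is CHOSEN (surjectivity of `χ₇` + prime-to-7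
         splitting, `Classical.choose`), so `γ₀`, `u`, `r`, `g` are noncomputable but closed terms.

HONEST LABEL: infrastructure (definitions + kernel lemmas); it closes no item, registers no stub, proves no summit
statement; stmt-BirchSwinnertonDyer-19945 is OPEN; `X12.CMRamifiedSeven` is NOT proved; BSD is claimed for no curve.
No `sorry`, no `instance`, no `notation`/`macro`, no named fact introduced, no attribute removed.

References: [Lang1990] S. Lang, Cyclotomic Fields I and II, Ch. 10 §1 (PDF p. 167: `γ`, `⟨a⟩ = γ^{α(a)}`, `r(a)`);
[Tsuji1999] T. Tsuji, Semi-local units modulo cyclotomic units, J. Number Theory 78 (1999), §3–§4; [Washington1997]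
L. Washington, Introduction to Cyclotomic Fields, Ch. 3–4 (conductors; Gauss sums, Lemma 4.7–4.8), Ch. 14 (p. 321);
[IrelandRosen1990] K. Ireland, M. Rosen, A Classical Introduction to Modern Number Theory, Ch. 6 §3 (the sign of the
quadratic Gauss sum squared, `g² = (−1)^{(p−1)/2} p`) and Ch. 13 §3; [Kato2004Asterisque] K. Kato, Astérisque 295, §15.5.
-/

noncomputable section

open scoped NumberField
open PowerSeries IsDedekindDomain
open Literature.NumberTheory.EllipticCurves
open Literature.NumberTheory.EllipticCurves.IwasawaAlgebra
open Literature.NumberTheory.IwasawaTheory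
open Literature.NumberTheory.IwasawaTheory.StickelbergerSeries
open Literature.NumberTheory.ComplexMultiplication.EllipticUnits

namespace Summit.BirchSwinnertonDyer.Rank1Residual.Additive.GenusSeven.ArithmeticInputs

/-! ## §A5 Gauss sums: `√(χ₄(m)·m) ∈ ℚ(μ_m)` with its Galois action by the Jacobi symbol (memo §1(b) row «F₀_le», M, template-less) -/

section Gauss

/-- `ℚ(μ_N) ⊆ ℚ̄` as an intermediate field: `ℚ` adjoined the `N`-th roots of unity (the letter of `GenusFrame.F₀_le`,
l.119, and of `cyclotomicLayer`). [cite: Washington1997, Ch. 2 (cyclotomic fields `ℚ(ζ_N)`)] -/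
def rootField (N : ℕ) : IntermediateField ℚ (AlgebraicClosure ℚ) :=
  IntermediateField.adjoin ℚ {x : AlgebraicClosure ℚ | x ^ N = 1}

/-- Unfolding `rootField`. [cite: Washington1997, Ch. 2] -/
theorem rootField_def (N : ℕ) :
    rootField N = IntermediateField.adjoin ℚ {x : AlgebraicClosure ℚ | x ^ N = 1} := rfl

/-- A root of unity of order dividing `N` lies in `ℚ(μ_N)`. [cite: Washington1997, Ch. 2] -/
theorem mem_rootField_of_pow_eq_one {N : ℕ} {ζ : AlgebraicClosure ℚ} (h : ζ ^ N = 1) : ζ ∈ rootField N :=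
  IntermediateField.subset_adjoin ℚ _ h

/-- `ℚ(μ_N) ⊆ ℚ(μ_M)` for `N ∣ M`. [cite: Washington1997, Ch. 2] -/
theorem rootField_mono {N M : ℕ} (h : N ∣ M) : rootField N ≤ rootField M := by
  apply IntermediateField.adjoin.mono
  intro x hx
  obtain ⟨k, rfl⟩ := h
  simp only [Set.mem_setOf_eq] at hx ⊢
  rw [pow_mul, hx, one_pow]

/-- **Quadratic Gauss sum at an odd prime `q`, in `ℚ̄`**: there is `G ∈ ℚ(μ_q)`, `G ≠ 0`, with `G² = χ₄(q)·q`
(`= (−1)^{(q−1)/2} q`, Ireland–Rosen Ch. 6 §3; Mathlib `gaussSum_sq` for the quadratic character of the FIELD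
`ZMod q` and a primitive additive character) on which every `σ ∈ Aut(ℚ̄/ℚ)` with `σζ = ζ^a` (`ζ ∈ μ_q`) acts by the
Legendre symbol: `σG = (a | q)·G` (`gaussSum_mulShift`: `g(χ, ψ^a) = χ(a)⁻¹ g(χ, ψ)`). [cite: IrelandRosen1990, Ch. 6 §3 (Prop. 6.3.2, `g² = (−1)^{(p−1)/2} p`) and Ch. 13 §3] [cite: Washington1997, Ch. 4 Lemma 4.7–4.8] -/
theorem exists_gaussSqrt_prime (q : ℕ) [hq : Fact q.Prime] (hq2 : q ≠ 2) :
    ∃ G ∈ rootField q, G ^ 2 = ((ZMod.χ₄ q : ℤ) : AlgebraicClosure ℚ) * q ∧ G ≠ 0 ∧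
      ∀ (σ : AlgebraicClosure ℚ ≃ₐ[ℚ] AlgebraicClosure ℚ) (a : ℕ),
        (∀ ζ : AlgebraicClosure ℚ, ζ ^ q = 1 → σ ζ = ζ ^ a) →
          σ G = (jacobiSym a q : AlgebraicClosure ℚ) * G := by
  classical
  obtain ⟨ζ, hζ⟩ := HasEnoughRootsOfUnity.exists_primitiveRoot (AlgebraicClosure ℚ) q
  have hζ1 : ζ ^ q = 1 := hζ.pow_eq_one
  set ψ : AddChar (ZMod q) (AlgebraicClosure ℚ) := AddChar.zmodChar q hζ1 with hψdef
  have hψ : ψ.IsPrimitive := AddChar.zmodChar_primitive_of_primitive_root q hζ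
  set χ : MulChar (ZMod q) (AlgebraicClosure ℚ) :=
    (quadraticChar (ZMod q)).ringHomComp (Int.castRingHom (AlgebraicClosure ℚ)) with hχdef
  have hχapp : ∀ x, χ x = ((quadraticChar (ZMod q) x : ℤ) : AlgebraicClosure ℚ) := fun x => rfl
  have hring : ringChar (ZMod q) ≠ 2 := by rw [ZMod.ringChar_zmod_n]; exact hq2
  have hχ2 : χ.IsQuadratic := (quadraticChar_isQuadratic (ZMod q)).comp _
  have hχ1 : χ ≠ 1 := by
    obtain ⟨a, ha⟩ := quadraticChar_exists_neg_one hring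
    have ha0 : a ≠ 0 := by
      rintro rfl
      rw [quadraticChar_zero] at ha
      exact absurd ha (by decide)
    intro h
    have h1 : χ a = 1 := by rw [h, MulChar.one_apply (isUnit_iff_ne_zero.mpr ha0)]
    rw [hχapp, ha] at h1
    norm_num at h1
  have hGsq : gaussSum χ ψ ^ 2 = ((ZMod.χ₄ q : ℤ) : AlgebraicClosure ℚ) * q := by
    rw [gaussSum_sq hχ1 hχ2 hψ, ZMod.card, hχapp, quadraticChar_neg_one hring, ZMod.card]
  refine ⟨gaussSum χ ψ, ?_, hGsq, ?_, ?_⟩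
  · -- membership in `ℚ(μ_q)`
    unfold gaussSum
    refine sum_mem fun x _ => mul_mem ?_ ?_
    · rw [hχapp]; exact intCast_mem _ _
    · rw [hψdef, AddChar.zmodChar_apply]; exact pow_mem (mem_rootField_of_pow_eq_one hζ1) _
  · -- `G ≠ 0`
    intro h0
    rw [h0, zero_pow two_ne_zero, eq_comm, mul_eq_zero] at hGsq
    rcases hGsq with h | h
    · rw [Int.cast_eq_zero, ZMod.χ₄_eq_neg_one_pow (Nat.odd_iff.mp (hq.1.odd_of_ne_two hq2))] at h
      exact pow_ne_zero _ (by norm_num) h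
    · exact (Nat.cast_ne_zero.mpr hq.1.ne_zero) h
  · intro σ a hσ
    by_cases hqa : (a : ZMod q) = 0
    · exfalso
      obtain ⟨c, hc⟩ := (ZMod.natCast_eq_zero_iff a q).mp hqa
      have h1 : σ ζ = 1 := by rw [hσ ζ hζ1, hc, pow_mul, hζ1, one_pow]
      have h2 : ζ = 1 := by
        have := congrArg σ.symm h1
        rwa [AlgEquiv.symm_apply_apply, map_one] at this
      exact hζ.ne_one hq.1.one_lt h2
    · have haU : IsUnit (a : ZMod q) := isUnit_iff_ne_zero.mpr hqa
      have hσG : σ (gaussSum χ ψ) = gaussSum χ (ψ.mulShift (a : ZMod q)) := by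
        unfold gaussSum
        rw [map_sum]
        refine Finset.sum_congr rfl fun x _ => ?_
        rw [map_mul, AddChar.mulShift_apply, hχapp, map_intCast, hψdef, AddChar.zmodChar_apply,
          AddChar.zmodChar_apply, map_pow, hσ ζ hζ1, ← pow_mul, ZMod.val_mul, ZMod.val_natCast,
          pow_eq_pow_mod (a * x.val) hζ1, ← pow_eq_pow_mod _ hζ1, Nat.mul_mod, Nat.mod_mod, ← Nat.mul_mod,
          ← pow_eq_pow_mod _ hζ1]
      have hmul := gaussSum_mulShift χ ψ haU.unit
      rw [haU.unit_spec] at hmul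
      have hχa : χ (a : ZMod q) = (jacobiSym a q : AlgebraicClosure ℚ) := by
        rw [hχapp, ← jacobiSym.legendreSym.to_jacobiSym, legendreSym, Int.cast_natCast]
      have hsq : χ (a : ZMod q) * χ (a : ZMod q) = 1 := by
        rcases hχ2 (a : ZMod q) with h | h | h
        · exfalso
          rw [hχapp, Int.cast_eq_zero, quadraticChar_eq_zero_iff] at h
          exact hqa h
        · rw [h, one_mul]
        · rw [h]; norm_num
      calc σ (gaussSum χ ψ) = gaussSum χ (ψ.mulShift (a : ZMod q)) := hσG
        _ = χ (a : ZMod q) * (χ (a : ZMod q) * gaussSum χ (ψ.mulShift (a : ZMod q))) := by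
          rw [← mul_assoc, hsq, one_mul]
        _ = (jacobiSym a q : AlgebraicClosure ℚ) * gaussSum χ ψ := by rw [hmul, hχa]

/-- **`√(χ₄(m)·m) ∈ ℚ(μ_m)` for odd squarefree `m`, with Galois action by the Jacobi symbol** (product of the prime
Gauss sums over `q ∣ m`: `G = ∏ g_q`, `G² = ∏ χ₄(q) q = χ₄(m) m`, `σG = ∏ (a|q)·G = (a|m)·G`; induction over the
coprime factorisation `Nat.recOnPosPrimePosCoprime`). [cite: IrelandRosen1990, Ch. 6 §3 and Ch. 13 §3] [cite: Washington1997, Ch. 4 Lemma 4.8] -/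
theorem exists_gaussSqrt {m : ℕ} (hm : Odd m) (hsq : Squarefree m) :
    ∃ G ∈ rootField m, G ^ 2 = ((ZMod.χ₄ m : ℤ) : AlgebraicClosure ℚ) * m ∧ G ≠ 0 ∧
      ∀ (σ : AlgebraicClosure ℚ ≃ₐ[ℚ] AlgebraicClosure ℚ) (a : ℕ),
        (∀ ζ : AlgebraicClosure ℚ, ζ ^ m = 1 → σ ζ = ζ ^ a) →
          σ G = (jacobiSym a m : AlgebraicClosure ℚ) * G := by
  induction m using Nat.recOnPosPrimePosCoprime with
  | zero => exact (not_squarefree_zero hsq).elim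
  | one =>
    refine ⟨1, one_mem _, by simp, one_ne_zero, fun σ a _ => ?_⟩
    rw [map_one, jacobiSym.one_right, Int.cast_one, one_mul]
  | prime_pow q n hq hn =>
    rcases Squarefree.eq_zero_or_one_of_pow_of_not_isUnit hsq hq.not_isUnit with h | h
    · omega
    · subst h
      haveI : Fact q.Prime := ⟨hq⟩
      have hq2 : q ≠ 2 := by rintro rfl; exact absurd hm (by decide)
      simpa only [pow_one] using exists_gaussSqrt_prime q hq2
  | coprime a b ha hb hab iha ihb =>
    have hma : Odd a := (Nat.odd_mul.mp hm).1
    have hmb : Odd b := (Nat.odd_mul.mp hm).2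
    have hsa : Squarefree a := ((Nat.squarefree_mul hab).mp hsq).1
    have hsb : Squarefree b := ((Nat.squarefree_mul hab).mp hsq).2
    obtain ⟨G₁, hG₁mem, hG₁sq, hG₁ne, hG₁gal⟩ := iha hma hsa
    obtain ⟨G₂, hG₂mem, hG₂sq, hG₂ne, hG₂gal⟩ := ihb hmb hsb
    refine ⟨G₁ * G₂, mul_mem (rootField_mono (dvd_mul_right a b) hG₁mem) (rootField_mono (dvd_mul_left b a) hG₂mem),
      ?_, mul_ne_zero hG₁ne hG₂ne, fun σ c hσ => ?_⟩
    · rw [mul_pow, hG₁sq, hG₂sq, Nat.cast_mul, Nat.cast_mul, map_mul, Int.cast_mul]; ring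
    · have hσa : ∀ ζ : AlgebraicClosure ℚ, ζ ^ a = 1 → σ ζ = ζ ^ c := fun ζ hζ =>
        hσ ζ (by rw [pow_mul, hζ, one_pow])
      have hσb : ∀ ζ : AlgebraicClosure ℚ, ζ ^ b = 1 → σ ζ = ζ ^ c := fun ζ hζ =>
        hσ ζ (by rw [mul_comm, pow_mul, hζ, one_pow])
      rw [map_mul, hG₁gal σ c hσa, hG₂gal σ c hσb, jacobiSym.mul_right' (c : ℤ) (by omega : a ≠ 0) (by omega : b ≠ 0),
        Int.cast_mul]
      ring

/-- **`ℚ(√D) ⊆ ℚ(μ_{|D|})`** for a negative squarefree `D ≡ 1 (mod 4)` — the letter of `GenusFrame.F₀_le` (l.119):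
`|D| ≡ 3 (mod 4)` so `χ₄(|D|)·|D| = −|D| = D` and the Gauss product `G` of `exists_gaussSqrt` is a square root of `D`
in `ℚ(μ_{|D|})`; `x² = D ⇒ x = ±G`. [cite: Washington1997, Ch. 4 Lemma 4.8 and Ch. 2 (quadratic subfields of cyclotomic fields)] [cite: IrelandRosen1990, Ch. 6 §3] -/
theorem quadraticField_le_adjoin_rootsOfUnity {D : ℤ} (hD : D < 0) (hD4 : D % 4 = 1) (hsq : Squarefree D) :
    IntermediateField.adjoin ℚ {x : AlgebraicClosure ℚ | x ^ 2 = (D : AlgebraicClosure ℚ)} ≤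
      IntermediateField.adjoin ℚ {x : AlgebraicClosure ℚ | x ^ D.natAbs = 1} := by
  have hodd : Odd D.natAbs := by rw [Int.natAbs_odd]; exact Int.odd_iff.mpr (by omega)
  have hsq' : Squarefree D.natAbs := Int.squarefree_natAbs.mpr hsq
  have h3 : D.natAbs % 4 = 3 := by omega
  obtain ⟨G, hGmem, hGsq, -, -⟩ := exists_gaussSqrt hodd hsq'
  have hcast : ((D.natAbs : ℕ) : AlgebraicClosure ℚ) = -(D : AlgebraicClosure ℚ) := by
    have : ((D.natAbs : ℕ) : ℤ) = -D := by omega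
    rw [← Int.cast_natCast, this, Int.cast_neg]
  have hG2 : G ^ 2 = (D : AlgebraicClosure ℚ) := by
    rw [hGsq, ZMod.χ₄_nat_three_mod_four h3, hcast]; push_cast; ring
  rw [IntermediateField.adjoin_le_iff]
  intro x hx
  simp only [Set.mem_setOf_eq] at hx
  rw [← hG2, sq_eq_sq_iff_eq_or_eq_neg] at hx
  rcases hx with rfl | rfl
  · exact hGmem
  · exact neg_mem hGmem

end Gauss

end Summit.BirchSwinnertonDyer.Rank1Residual.Additive.GenusSeven.ArithmeticInputs

end
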